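import Literature.NumberTheory.Automorphic.TwistedQuotientRationalEigenclassLattice
import Literature.NumberTheory.Automorphic.TwistedQuotientIndFunDirectedFiniteType
import HarnessLib

/-!
# A rational Hecke eigenclass is the image of an exact integral eigenclass of bounded content —
# from the finite-type property of the stabilisers (no `FP_∞` resolution)

Topic `NumberTheory/Automorphic`; namespace `Literature.NumberTheory.Automorphic.TwistedQuotient`.
Definitions with bodies (the `K`-scalar morphisms `scaleCoeff`, `scaleIntFun`) and theorems; no
named fact, no instance, no `sorry`.  Sequel of `TwistedQuotientRationalEigenclassLattice`.

`exists_intFun_exact_eigenclass_of_cohFiniteType` has the same conclusion as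
`exists_intFun_exact_eigenclass` (an exact integral eigenclass `c ∈ H^q(Γ, M̃_s)` of bounded
content on a free scaled lattice, mapping to the given rational eigenclass `ξ`), but its
finiteness hypothesis on the stabilisers `Γ_x` of the finitely many `Γ`-orbits on `𝒢 ⧸ L` is the
COHOMOLOGICAL `IsCohFiniteTypeUpTo k Γ_x m` (`Literature/Algebra/Homology/GroupCohomologyFiniteType`:
finitely generated values, and commutation with directed unions up to a multiplier `m`, `m`
invertible in `K`) instead of a projective resolution of finite type.  This is the form that
survives commensurability (ascent along a subgroup of finite index introduces the multiplier) and
that Brown's criterion with an equivariant good cover provides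
(`GroupCohomologyGoodCoverFiniteType`), so that the integral comparison of
[Scholze2015, §V.4, proof of Thm. V.4.1] runs for every arithmetic group commensurable with one
admitting such a cover.

The multiplier is removed by the `K`-SCALABILITY of the system of scaled lattices `M_s`: for
`c m = 1` in `K`, multiplication by `c` maps `M_s` into `M_{s'}`, `s' = s ∪ {c} ∪ c·s`
(`smul_mem_scaledLattice_of_mem`), the inclusion `M̃_s ↪ M̃_{s'}` factors as `(m • 𝟙) ≫ (c ·)`
(`intFunIncl_eq_nsmul_comp_scaleIntFun`), and on `H^q_k(S_L, Ṽ)` the scalar `c` undoes `m •`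
(`cohMapQ_scaleCoeff_nsmul`).  Hence `m • ξ` hit ⟹ `ξ` hit (`exists_intFun_map_eq_of_cohFiniteType`)
and `m • y` dies ⟹ `y` dies (`exists_intFunIncl_map_eq_zero_of_cohFiniteType`); the rest of the
proof is that of `exists_intFun_exact_eigenclass` verbatim.

## References

* P. Scholze, *On torsion in the cohomology of locally symmetric varieties*, Ann. of Math. 182
  (2015), §V.4, proof of Thm. V.4.1. [Scholze2015]
* K. S. Brown, *Cohomology of Groups*, GTM 87 (1982), VIII (4.6), (4.8), VIII.4 Ex. 1.
  [Brown1982CohomologyGroups]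
-/

noncomputable section

open CategoryTheory Literature.Algebra.Homology Literature.Algebra.Module
open scoped Classical

universe u

namespace Literature.NumberTheory.Automorphic

namespace TwistedQuotient

open IntegralEigenclass

variable {k K : Type u} [CommRing k] [CommRing K] [Algebra k K] {Γ 𝒢 : Type u} [Group Γ] [Group 𝒢]
  (ι : Γ →* 𝒢) (L : Subgroup 𝒢) {V : Type u} [AddCommGroup V] [Module K V] [Module k V]
  [IsScalarTower k K V] (π : Representation K 𝒢 V)

/-! ### `K`-scalars on `Fun(𝒢 ⧸ L, V)_ρ` and on the integral functions -/

section Scale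

variable (k) in
/-- **Multiplication by `c ∈ K`** on the coefficient representation `Fun(𝒢 ⧸ L, V)_ρ`,
`ρ = π|_Γ` over `k` (it commutes with the twisted action, `π` being `K`-linear). [folklore] -/
def scaleCoeff (c : K) :
    coeffRep ι L ((resScalars k π).comp ι) ⟶ coeffRep ι L ((resScalars k π).comp ι) :=
  Rep.ofHom ⟨(scaleMap (k := k) c).compLeft (𝒢 ⧸ L), fun γ => LinearMap.ext fun f => funext fun x => by
    change c • coeffRepresentation ι L ((resScalars k π).comp ι) γ f x =
      coeffRepresentation ι L ((resScalars k π).comp ι) γ (fun y => c • f y) x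
    simp only [coeffRepresentation_apply, MonoidHom.comp_apply, resScalars_apply, map_smul]⟩

/-- Unfolding lemma. [folklore] -/
@[simp]
theorem scaleCoeff_hom_apply (c : K) (f : coeffRep ι L ((resScalars k π).comp ι)) (x : 𝒢 ⧸ L) :
    ((scaleCoeff k ι L π c).hom f : (𝒢 ⧸ L) → V) x = c • (f : (𝒢 ⧸ L) → V) x :=
  rfl

/-- `(c ·) ≫ (c' ·) = (c' c ·)`. [folklore] -/
theorem scaleCoeff_comp (c c' : K) :
    scaleCoeff k ι L π c ≫ scaleCoeff k ι L π c' = scaleCoeff k ι L π (c' * c) :=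
  Rep.hom_ext (Representation.IntertwiningMap.ext (LinearMap.ext fun f => funext fun x => by
    change c' • (c • (f : (𝒢 ⧸ L) → V) x) = (c' * c) • (f : (𝒢 ⧸ L) → V) x
    rw [smul_smul]))

/-- `(1 ·) = 𝟙`. [folklore] -/
theorem scaleCoeff_one : scaleCoeff k ι L π (1 : K) = 𝟙 _ :=
  Rep.hom_ext (Representation.IntertwiningMap.ext (LinearMap.ext fun f => funext fun x => by
    change (1 : K) • (f : (𝒢 ⧸ L) → V) x = (f : (𝒢 ⧸ L) → V) x
    rw [one_smul]))

/-- `((m : K) ·) = m • 𝟙`. [folklore] -/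
theorem scaleCoeff_natCast (m : ℕ) : scaleCoeff k ι L π ((m : ℕ) : K) = m • 𝟙 _ :=
  Rep.hom_ext (Representation.IntertwiningMap.ext (LinearMap.ext fun f => funext fun x => by
    change ((m : ℕ) : K) • (f : (𝒢 ⧸ L) → V) x = ((m • 𝟙 (coeffRep ι L ((resScalars k π).comp ι)) :
      _ ⟶ _).hom f : (𝒢 ⧸ L) → V) x
    rw [Rep.nsmul_hom, Nat.cast_smul_eq_nsmul]
    rfl))

/-- **On cohomology `c` undoes `m •` when `c m = 1`**: `H^q(c ·) (m • ξ) = ξ`. [folklore] -/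
theorem cohMapQ_scaleCoeff_nsmul {c : K} {m : ℕ} (hc : c * m = 1) (q : ℕ)
    (ξ : groupCohomology (coeffRep ι L ((resScalars k π).comp ι)) q) :
    cohMapQ (scaleCoeff k ι L π c) q (m • ξ) = ξ := by
  have h1 : m • ξ = cohMapQ (scaleCoeff k ι L π ((m : ℕ) : K)) q ξ := by
    rw [scaleCoeff_natCast]
    exact (map_nsmul_id_apply _ m q ξ).symm
  rw [h1, ← cohMapQ_comp, scaleCoeff_comp, hc, scaleCoeff_one]
  change ((groupCohomology.functor k Γ q).map (𝟙 _)).hom ξ = ξ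
  rw [CategoryTheory.Functor.map_id]
  rfl

variable {P P' P'' : Submodule k V}

/-- **Multiplication by `c ∈ K` on integral functions**, `M̃_P → M̃_{P'}` when `c • P ⊆ P'`.
[folklore] -/
def scaleIntFun (c : K) (hcP : ∀ v ∈ P, c • v ∈ P') :
    intFun ι L (resScalars k π) P ⟶ intFun ι L (resScalars k π) P' :=
  Rep.ofHom ⟨((scaleMap (k := k) c).compLeft (𝒢 ⧸ L)).restrict (p := intFunSubmodule L (resScalars k π) P)
      (q := intFunSubmodule L (resScalars k π) P') fun f hf g => by
        change resScalars k π g⁻¹ (c • f (g : 𝒢 ⧸ L)) ∈ P'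
        rw [resScalars_apply, map_smul]
        exact hcP _ (hf g),
    fun γ => LinearMap.ext fun f => Subtype.ext (funext fun x => by
      change c • coeffRepresentation ι L ((resScalars k π).comp ι) γ f.1 x =
        coeffRepresentation ι L ((resScalars k π).comp ι) γ (fun y => c • f.1 y) x
      simp only [coeffRepresentation_apply, MonoidHom.comp_apply, resScalars_apply, map_smul])⟩

/-- Unfolding lemma. [folklore] -/
@[simp]
theorem val_scaleIntFun_hom_apply (c : K) (hcP : ∀ v ∈ P, c • v ∈ P')
    (f : intFun ι L (resScalars k π) P) (x : 𝒢 ⧸ L) :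
    ((scaleIntFun ι L π c hcP).hom f).1 x = c • f.1 x :=
  rfl

/-- `(c ·) ≫ intFunι = intFunι ≫ (c ·)`. [folklore] -/
theorem scaleIntFun_comp_intFunι (c : K) (hcP : ∀ v ∈ P, c • v ∈ P') :
    scaleIntFun ι L π c hcP ≫ intFunι ι L (resScalars k π) P' =
      intFunι ι L (resScalars k π) P ≫ scaleCoeff k ι L π c :=
  Rep.hom_ext (Representation.IntertwiningMap.ext (LinearMap.ext fun _ => funext fun _ => rfl))

/-- Composition of inclusions of integral functions (stated for abstract lattices). [folklore] -/
theorem intFunIncl_comp (h : P ≤ P') (h' : P' ≤ P'') :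
    intFunIncl ι L (resScalars k π) h ≫ intFunIncl ι L (resScalars k π) h' =
      intFunIncl ι L (resScalars k π) (h.trans h') :=
  Rep.hom_ext (Representation.IntertwiningMap.ext (LinearMap.ext fun _ => Subtype.ext (funext fun _ => rfl)))

/-- **The inclusion `M̃_P ↪ M̃_{P'}` factors as `(m • 𝟙) ≫ (c ·)` when `c m = 1` and
`c • P ⊆ P'`.** [folklore] -/
theorem intFunIncl_eq_nsmul_comp_scaleIntFun (h : P ≤ P') {c : K} {m : ℕ} (hc : c * m = 1)
    (hcP : ∀ v ∈ P, c • v ∈ P') :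
    intFunIncl ι L (resScalars k π) h = (m • 𝟙 _) ≫ scaleIntFun ι L π c hcP := by
  refine Rep.hom_ext (Representation.IntertwiningMap.ext (LinearMap.ext fun f => Subtype.ext
    (funext fun x => ?_)))
  change f.1 x = c • (((m • 𝟙 (intFun ι L (resScalars k π) P) : _ ⟶ _).hom f).1 x)
  rw [Rep.nsmul_hom]
  change f.1 x = c • (m • f.1 x)
  rw [← Nat.cast_smul_eq_nsmul K, smul_smul, hc, one_smul]

end Scale

/-! ### The scaled-lattice system: removing the multiplier -/

variable (M : Submodule k V) (hM : ∀ l ∈ L, ∀ m ∈ M, resScalars k π l m ∈ M)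

variable (s₀ : Finset 𝒢)
  (hdisj : ∀ x ∈ s₀, ∀ y ∈ s₀, (∃ γ : Γ, ι γ • (x : 𝒢 ⧸ L) = (y : 𝒢 ⧸ L)) → x = y)
  (hcov : ∀ g : 𝒢, ∃ x ∈ s₀, ∃ γ : Γ, ι γ • (x : 𝒢 ⧸ L) = (g : 𝒢 ⧸ L))

/-- `c • M_s ⊆ M_{s ∪ ({c} ∪ c·s)}`. [folklore] -/
theorem smul_mem_scaledLattice_union (s : Finset K) (c : K) (v : V) (hv : v ∈ scaledLattice M s) :
    c • v ∈ scaledLattice M (s ∪ insert c (s.image (c * ·))) :=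
  scaledLattice_mono M Finset.subset_union_right (smul_mem_scaledLattice_of_mem M c hv)

include hM hdisj hcov in
/-- **Every class of `H^q_k(S_L, Ṽ)` is the image of a class of some `H^q(Γ, M̃_s)`**, from the
finite-type property of the stabilisers up to a multiplier `m` invertible in `K`.
[cite: Scholze2015, §V.4 (proof of Thm. V.4.1)] [cite: Brown1982CohomologyGroups, VIII (4.6)] -/
theorem exists_intFun_map_eq_of_cohFiniteType (hspan : Submodule.span K (M : Set V) = ⊤) {m : ℕ}
    (hFT : ∀ x ∈ s₀, IsCohFiniteTypeUpTo k (orbitStabilizer ι L (x : 𝒢 ⧸ L)) m)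
    (hm : ∃ c : K, c * m = 1) (q : ℕ)
    (ξ : groupCohomology (coeffRep ι L ((resScalars k π).comp ι)) q) :
    ∃ (s : Finset K) (y : groupCohomology (intFun ι L (resScalars k π) (scaledLattice M s)) q),
      cohMapQ (intFunι ι L (resScalars k π) (scaledLattice M s)) q y = ξ := by
  classical
  obtain ⟨c, hc⟩ := hm
  -- Step A: `m • ξ` is hit at some stage `s`
  have hA : ∃ (s : Finset K) (y : groupCohomology (intFun ι L (resScalars k π) (scaledLattice M s)) q),
      cohMapQ (intFunι ι L (resScalars k π) (scaledLattice M s)) q y = m • ξ := by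
    let isoTop := intFunIso ι L (resScalars k π) ⊤ (top_stable L (resScalars k π))
    let eTop := intFunTopIso ι L (resScalars k π)
    let z : groupCohomology (indFun ι L (topRep L π)) q := cohMapQ isoTop.hom q (cohMapQ eTop.inv q ξ)
    obtain ⟨s, y₁, hy₁⟩ := exists_map_indFunMap_eq_of_cohFiniteType ι L (topRep L π)
      (scaledRep L π M hM) (scaledToTop L π M hM)
      (fun s => latticeIncl_injective L (resScalars k π) (le_top : scaledLattice M s ≤ ⊤)
        (scaledLattice_stable M π L hM s) (top_stable L (resScalars k π)))
      (fun _ _ h => scaledTransition L π M hM h) (fun _ _ h v => scaledToTop_scaledTransition L π M hM h v)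
      (exists_scaledToTop_eq L π M hM hspan) s₀ hdisj hcov hFT q z
    let isoS := intFunIso ι L (resScalars k π) (scaledLattice M s) (scaledLattice_stable M π L hM s)
    refine ⟨s, cohMapQ isoS.inv q y₁, ?_⟩
    have hy₁' : cohMapQ (indFunMap ι L _ _ (scaledToTop L π M hM s)) q y₁ = m • z := hy₁
    rw [← cohMapQ_comp, intFunIso_inv_comp_intFunι ι L π M hM s, cohMapQ_comp, cohMapQ_comp, hy₁',
      map_nsmul, map_nsmul]
    show m • cohMapQ eTop.hom q (cohMapQ isoTop.inv q (cohMapQ isoTop.hom q (cohMapQ eTop.inv q ξ))) = m • ξ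
    rw [cohMapQ_inv_hom, cohMapQ_hom_inv]
  obtain ⟨s, y, hy⟩ := hA
  -- Step B: scale by `c`
  refine ⟨s ∪ insert c (s.image (c * ·)),
    cohMapQ (scaleIntFun ι L π c (smul_mem_scaledLattice_union M s c)) q y, ?_⟩
  rw [← cohMapQ_comp, scaleIntFun_comp_intFunι, cohMapQ_comp, hy]
  exact cohMapQ_scaleCoeff_nsmul ι L π hc q ξ

include hM hdisj hcov in
/-- **A class of `H^q(Γ, M̃_s)` dying in `H^q_k(S_L, Ṽ)` dies in some `H^q(Γ, M̃_{s'})`, `s' ≥ s`**,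
from the finite-type property of the stabilisers up to a multiplier invertible in `K`.
[cite: Scholze2015, §V.4 (proof of Thm. V.4.1)] [cite: Brown1982CohomologyGroups, VIII (4.6)] -/
theorem exists_intFunIncl_map_eq_zero_of_cohFiniteType (hspan : Submodule.span K (M : Set V) = ⊤)
    {m : ℕ} (hFT : ∀ x ∈ s₀, IsCohFiniteTypeUpTo k (orbitStabilizer ι L (x : 𝒢 ⧸ L)) m)
    (hm : ∃ c : K, c * m = 1) (q : ℕ)
    (s : Finset K) (y : groupCohomology (intFun ι L (resScalars k π) (scaledLattice M s)) q)
    (hy : cohMapQ (intFunι ι L (resScalars k π) (scaledLattice M s)) q y = 0) :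
    ∃ (s' : Finset K) (h : s ≤ s'),
      cohMapQ (intFunIncl ι L (resScalars k π) (scaledLattice_mono M h)) q y = 0 := by
  classical
  obtain ⟨c, hc⟩ := hm
  -- Step A: `m • y` dies at some stage `s₁ ≥ s` (as in `exists_intFunIncl_map_eq_zero`)
  have hA : ∃ (s₁ : Finset K) (h : s ≤ s₁),
      cohMapQ (intFunIncl ι L (resScalars k π) (scaledLattice_mono M h)) q (m • y) = 0 := by
    let isoTop := intFunIso ι L (resScalars k π) ⊤ (top_stable L (resScalars k π))
    let eTop := intFunTopIso ι L (resScalars k π)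
    let isoS := intFunIso ι L (resScalars k π) (scaledLattice M s) (scaledLattice_stable M π L hM s)
    let y₁ : groupCohomology (indFun ι L (scaledRep L π M hM s)) q := cohMapQ isoS.hom q y
    have hsq : isoS.hom ≫ indFunMap ι L _ _ (scaledToTop L π M hM s) =
        intFunι ι L (resScalars k π) (scaledLattice M s) ≫ eTop.inv ≫ isoTop.hom := by
      rw [intFunIso_hom_comp_indFunMap, intFunι_eq_intFunIncl_comp, Category.assoc,
        Iso.hom_inv_id_assoc]
    have hy₁ : groupCohomology.map (MonoidHom.id Γ) (indFunMap ι L _ _ (scaledToTop L π M hM s)) q y₁ = 0 := by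
      show cohMapQ (indFunMap ι L _ _ (scaledToTop L π M hM s)) q (cohMapQ isoS.hom q y) = 0
      rw [← cohMapQ_comp, hsq, cohMapQ_comp, hy, map_zero]
    obtain ⟨s', h, hs'⟩ := exists_map_indFunMap_eq_zero_of_cohFiniteType ι L (topRep L π)
      (scaledRep L π M hM) (scaledToTop L π M hM)
      (fun s => latticeIncl_injective L (resScalars k π) (le_top : scaledLattice M s ≤ ⊤)
        (scaledLattice_stable M π L hM s) (top_stable L (resScalars k π)))
      (fun _ _ h => scaledTransition L π M hM h) (fun _ _ h v => scaledToTop_scaledTransition L π M hM h v)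
      (exists_scaledToTop_eq L π M hM hspan) s₀ hdisj hcov hFT q s y₁ hy₁
    refine ⟨s', h, ?_⟩
    let isoS' := intFunIso ι L (resScalars k π) (scaledLattice M s') (scaledLattice_stable M π L hM s')
    have hsq' : isoS.hom ≫ indFunMap ι L _ _ (scaledTransition L π M hM h) =
        intFunIncl ι L (resScalars k π) (scaledLattice_mono M h) ≫ isoS'.hom :=
      intFunIso_hom_comp_indFunMap ι L (resScalars k π) (scaledLattice_mono M h)
        (scaledLattice_stable M π L hM s) (scaledLattice_stable M π L hM s')
    have hs'' : cohMapQ (indFunMap ι L _ _ (scaledTransition L π M hM h)) q (m • y₁) = 0 := hs'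
    apply cohMapQ_injective_of_iso isoS' q
    rw [map_zero, ← cohMapQ_comp, ← hsq', cohMapQ_comp, map_nsmul]
    have hmy : cohMapQ isoS.hom q (m • y) = m • y₁ := by rw [map_nsmul]
    rw [← map_nsmul, hmy]
    exact hs''
  obtain ⟨s₁, h₁, hs₁⟩ := hA
  -- Step B: one more stage absorbing `c`
  let s' : Finset K := s₁ ∪ insert c (s₁.image (c * ·))
  have h₁' : s₁ ≤ s' := Finset.subset_union_left
  refine ⟨s', h₁.trans h₁', ?_⟩
  rw [← intFunIncl_comp ι L π (scaledLattice_mono M h₁) (scaledLattice_mono M h₁'), cohMapQ_comp,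
    intFunIncl_eq_nsmul_comp_scaleIntFun ι L π (scaledLattice_mono M h₁') hc
      (smul_mem_scaledLattice_union M s₁ c), cohMapQ_comp]
  have hn : cohMapQ (m • 𝟙 (intFun ι L (resScalars k π) (scaledLattice M s₁))) q
      (cohMapQ (intFunIncl ι L (resScalars k π) (scaledLattice_mono M h₁)) q y) =
      cohMapQ (intFunIncl ι L (resScalars k π) (scaledLattice_mono M h₁)) q (m • y) := by
    rw [map_nsmul]
    exact map_nsmul_id_apply _ m q _
  rw [hn, hs₁, map_zero]

/-! ### Finiteness of `H^q(Γ, M̃_s)` -/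

include hM hdisj hcov in
/-- `H^q(Γ, M̃_s)` is a finitely generated `k`-module (`k` Noetherian, `M` finitely generated,
stabilisers of finite type). [cite: Brown1982CohomologyGroups, VIII.4 Ex. 1] -/
theorem moduleFinite_cohomology_intFun_scaledLattice_of_cohFiniteType [IsNoetherianRing k]
    (hMfg : M.FG) {m : ℕ}
    (hFT : ∀ x ∈ s₀, IsCohFiniteTypeUpTo k (orbitStabilizer ι L (x : 𝒢 ⧸ L)) m) (q : ℕ)
    (s : Finset K) :
    Module.Finite k (groupCohomology (intFun ι L (resScalars k π) (scaledLattice M s)) q) := by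
  haveI : Module.Finite k (scaledLattice M s) := Module.Finite.iff_fg.2 (scaledLattice_fg M hMfg s)
  haveI : Module.Finite k (groupCohomology (indFun ι L (scaledRep L π M hM s)) q) :=
    moduleFinite_cohomology_indFun_of_orbits ι L (scaledRep L π M hM s) s₀ hdisj hcov q
      fun x hx => (hFT x hx).moduleFinite (indStabilizerRep ι L (scaledRep L π M hM s) x) q
  let e := intFunIso ι L (resScalars k π) (scaledLattice M s) (scaledLattice_stable M π L hM s)
  exact Module.Finite.of_surjective (cohMapQ e.inv q) fun x => ⟨cohMapQ e.hom q x, cohMapQ_inv_hom e q x⟩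

/-! ### The main theorem -/

include hM hdisj hcov in
/-- **A rational eigenclass comes from an exact integral eigenclass of bounded content on a free
lattice — finite-type stabilisers.**  Same statement and proof as
`exists_intFun_exact_eigenclass`, with the `FP_∞` hypothesis replaced by
`IsCohFiniteTypeUpTo k Γ_x m`, `m` invertible in `K`. [cite: Scholze2015, §V.4 (proof of Thm. V.4.1)] -/
theorem exists_intFun_exact_eigenclass_of_cohFiniteType [IsDomain k] [IsPrincipalIdealRing k] [IsLocalRing k]
    [Module.IsTorsionFree k V] (hMfg : M.FG) (hspan : Submodule.span K (M : Set V) = ⊤)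
    {p : ℕ} (hp : (p : k) ∈ IsLocalRing.maximalIdeal k)
    {m : ℕ} (hFT : ∀ x ∈ s₀, IsCohFiniteTypeUpTo k (orbitStabilizer ι L (x : 𝒢 ⧸ L)) m)
    (hm : ∃ c : K, c * m = 1)
    {J : Type*} (δ : J → 𝒢) (hδ : ∀ j, resScalars k π (δ j) = 1) (χ : J → k)
    (Lev : ℕ → Subgroup 𝒢)
    (hcong : ∀ t' : ℕ, ∃ r : ℕ, ∀ l ∈ L, l ∈ Lev r → ∀ m ∈ M,
      π l m - m ∈ (Ideal.span {((p ^ t' : ℕ) : k)} : Ideal k) • M)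
    {q : ℕ} (ξ : groupCohomology (coeffRep ι L ((resScalars k π).comp ι)) q)
    (hξ : ∀ m : ℕ, (p : k) ^ m • ξ ≠ 0)
    (heig : ∀ j, heckeEnd ι L ((resScalars k π).comp ι) (δ j) q ξ = χ j • ξ) :
    ∃ (M' : Submodule k V) (hM' : ∀ l ∈ L, ∀ m ∈ M', resScalars k π l m ∈ M') (d : ℕ)
      (_ : M' ≃ₗ[k] (Fin d → k))
      (c : groupCohomology (intFun ι L (resScalars k π) M') q) (m₀ : ℕ),
      M ≤ M' ∧
      (∀ t' : ℕ, ∃ r : ℕ, ModTrivialOn (resScalars k π) M' hM' (p ^ t') (Lev r)) ∧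
      (∀ j, (groupCohomology.map (MonoidHom.id Γ) (A := intFun ι L (resScalars k π) M')
        (B := intFun ι L (resScalars k π) M')
        (heckeIntHom ι L (resScalars k π) M' hM' (rep_mem_of_eq_one _ M' (hδ j))) q).hom c = χ j • c) ∧
      cohMapQ (intFunι ι L (resScalars k π) M') q c = ξ ∧
      ∀ (u : ℕ) (y : groupCohomology (intFun ι L (resScalars k π) M') q),
        (p : k) ^ u • c ≠ (p : k) ^ (u + m₀) • y := by
  haveI : IsNoetherianRing k := inferInstance
  -- Step 1: `ξ` comes from some `M̃_s`
  obtain ⟨s, y, hy⟩ := exists_intFun_map_eq_of_cohFiniteType ι L π M hM s₀ hdisj hcov hspan hFT hm q ξ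
  -- notation: cohomology of `M̃_t`, the maps to `H^q_k(S_L, Ṽ)`, the inclusions, the Hecke operators
  let H : Finset K → Type u := fun t => groupCohomology (intFun ι L (resScalars k π) (scaledLattice M t)) q
  let f : ∀ t : Finset K, H t →ₗ[k] groupCohomology (coeffRep ι L ((resScalars k π).comp ι)) q :=
    fun t => cohMapQ (intFunι ι L (resScalars k π) (scaledLattice M t)) q
  let incl : ∀ {t t' : Finset K}, t ≤ t' → (H t →ₗ[k] H t') := fun h =>
    cohMapQ (intFunIncl ι L (resScalars k π) (scaledLattice_mono M h)) q
  let T : ∀ (t : Finset K) (_ : J), H t →ₗ[k] H t := fun t j =>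
    cohMapQ (heckeIntHom ι L (resScalars k π) (scaledLattice M t) (scaledLattice_stable M π L hM t)
      (rep_mem_of_eq_one _ _ (hδ j))) q
  have hf_incl : ∀ {t t' : Finset K} (h : t ≤ t') (x : H t), f t' (incl h x) = f t x := by
    intro t t' h x
    show cohMapQ _ q (cohMapQ _ q x) = cohMapQ _ q x
    rw [← cohMapQ_comp, intFunIncl_comp_intFunι]
  have hTf : ∀ (t : Finset K) (j : J) (x : H t),
      f t (T t j x) = heckeEnd ι L ((resScalars k π).comp ι) (δ j) q (f t x) := by
    intro t j x
    show cohMapQ _ q (cohMapQ _ q x) = cohMapQ _ q (cohMapQ _ q x)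
    rw [← cohMapQ_comp, heckeIntHom_comp_intFunι, cohMapQ_comp]
  have hTincl : ∀ {t t' : Finset K} (h : t ≤ t') (j : J) (x : H t),
      incl h (T t j x) = T t' j (incl h x) := by
    intro t t' h j x
    show cohMapQ _ q (cohMapQ _ q x) = cohMapQ _ q (cohMapQ _ q x)
    rw [← cohMapQ_comp, heckeIntHom_comp_intFunIncl, cohMapQ_comp]
  haveI : ∀ t, Module.Finite k (H t) := fun t =>
    moduleFinite_cohomology_intFun_scaledLattice_of_cohFiniteType ι L π M hM s₀ hdisj hcov hMfg hFT q t
  -- Step 2: a bigger `S ⊇ s` and a comparison map `g : H s → H S` killing `ker (f s)`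
  have hker : ∃ (S : Finset K) (g : H s →ₗ[k] H S), M ≤ scaledLattice M S ∧
      (∀ x, f S (g x) = f s x) ∧ (∀ j x, g (T s j x) = T S j (g x)) ∧ ∀ x, f s x = 0 → g x = 0 := by
    obtain ⟨G, hG⟩ := (IsNoetherian.noetherian (LinearMap.ker (f s)) : (LinearMap.ker (f s)).FG)
    -- kill the generators one at a time, enlarging the lattice
    have step : ∀ G' : Finset (H s), G' ⊆ G → ∃ (S : Finset K) (g : H s →ₗ[k] H S),
        M ≤ scaledLattice M S ∧ (∀ x, f S (g x) = f s x) ∧ (∀ j x, g (T s j x) = T S j (g x)) ∧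
        ∀ x ∈ G', g x = 0 := by
      intro G'
      induction G' using Finset.induction_on with
      | empty =>
        intro
        exact ⟨s, LinearMap.id, le_scaledLattice M s, fun x => rfl, fun j x => rfl,
          fun x hx => absurd hx (Finset.notMem_empty x)⟩
      | insert a G' ha ih =>
        intro hsub
        obtain ⟨S, g, hMS, hgf, hgT, hgG⟩ := ih ((Finset.subset_insert a G').trans hsub)
        have ha0 : f S (g a) = 0 := by
          rw [hgf]
          have haG : a ∈ Submodule.span k (G : Set (H s)) :=
            Submodule.subset_span (hsub (Finset.mem_insert_self a G'))
          rw [hG] at haG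
          exact haG
        obtain ⟨S', hSS', hkill⟩ :=
          exists_intFunIncl_map_eq_zero_of_cohFiniteType ι L π M hM s₀ hdisj hcov hspan hFT hm q S (g a) ha0
        refine ⟨S', incl hSS' ∘ₗ g, hMS.trans (scaledLattice_mono M hSS'), fun x => ?_, fun j x => ?_,
          fun x hx => ?_⟩
        · rw [LinearMap.comp_apply, hf_incl hSS', hgf]
        · rw [LinearMap.comp_apply, LinearMap.comp_apply, hgT, hTincl hSS']
        · rw [LinearMap.comp_apply]
          rcases Finset.mem_insert.1 hx with rfl | hx
          · exact hkill
          · rw [hgG x hx, map_zero]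
    obtain ⟨S, g, hMS, hgf, hgT, hgG⟩ := step G subset_rfl
    refine ⟨S, g, hMS, hgf, hgT, fun x hx => ?_⟩
    have hxspan : x ∈ Submodule.span k (G : Set (H s)) := by rw [hG]; exact hx
    clear hx
    induction hxspan using Submodule.span_induction with
    | mem x hxG => exact hgG x hxG
    | zero => exact map_zero g
    | add x y _ _ hx hy => rw [map_add, hx, hy, add_zero]
    | smul a x _ hx => rw [map_smul, hx, smul_zero]
  obtain ⟨S, g, hMS, hgf, hgT, hgker⟩ := hker
  -- Step 3: the lattice `M' = M_S` and the class `c = g y`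
  let M' := scaledLattice M S
  have hM' := scaledLattice_stable M π L hM S
  let c : H S := g y
  have hfc : f S c = ξ := by rw [hgf]; exact hy
  -- exact eigenclass
  have heigc : ∀ j, T S j c = χ j • c := by
    intro j
    have h0 : f s (T s j y - χ j • y) = 0 := by
      rw [map_sub, map_smul, hTf, hy, heig, sub_self]
    have h1 := hgker _ h0
    rw [map_sub, map_smul, hgT] at h1
    exact sub_eq_zero.1 h1
  -- freeness (`M'` finitely generated and torsion-free over the principal ideal domain `k`)
  haveI : Module.Finite k M' := Module.Finite.iff_fg.2 (scaledLattice_fg M hMfg S)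
  -- content bound
  have hc : ∀ m : ℕ, (p : k) ^ m • c ≠ 0 := fun m h0 =>
    hξ m (by rw [← hfc, ← map_smul, h0, map_zero])
  obtain ⟨m₀, hm₀⟩ := exists_content_bound hp c hc
  -- congruences
  have hmod : ∀ t' : ℕ, ∃ r : ℕ, ModTrivialOn (resScalars k π) M' hM' (p ^ t') (Lev r) := by
    intro t'
    obtain ⟨r, hr⟩ := hcong t'
    exact ⟨r, modTrivialOn_scaledLattice M π L hM (p ^ t') (Lev r)
      (fun l hl hl' m hm => hr l hl hl' m hm) S⟩
  exact ⟨M', hM', Module.finrank k M', (Module.finBasis k M').equivFun, c, m₀,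
    hMS, hmod, heigc, hfc, hm₀⟩

end TwistedQuotient

end Literature.NumberTheory.Automorphic
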